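import Summits.QuantumFields.YangMills.Theorems.BalabanUVNodesN12AtRecord12TermPinned

/-!
# BalabanUVNodes ∕ N12 AT THE TERM-PINNED LAYER, WINDOW-FREE FORM — and the kernel census «the (1.89) discharge route is VOID at the witness numerics of record
# (`towerNumericsOfRecord₁₂.Nmem = 0`)»
# (sequel of `BalabanUVNodesN12AtRecord12TermPinned`; Track A, DAG node N12 = [B15, Balaban1989LargeFieldI] CMP 122 (1989) 175; cluster K1′ `StabilityBAtRecordR12e` =
# stmt-QuantumFields-19903 (rev 15); seat `pub-ymgap-dag-n12-d` g5 (R134 s2; dag-n12-e g4's SPLIT, pub-ymgap INBOX l.15340 (3)), 2026-08-27; count-neutral, NOT a discharge)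

HONEST FRAMING.  Count-neutral kernel BOOKKEEPING BY NAME + two `rfl` ∕ `omega` census facts; nothing of Bałaban's asserted; N12 NOT discharged.

WHY THIS FILE.  dag-n12-e's module 11 v1.1 (`B15Claim189PrintedConditions`, p484369) adds the WINDOW-FREE form `h189_pinD189T_of_h180_of_flow` of the (1.89) discharge
(flow inputs `0 ≤ ε_i ≤ 1∕10` on `[k′−N, k′]` and [III] (2.8) `ε_{k′} ≤ (1+β₀)√(k′−j)·ε_j` DISPLAYED at the thresholds of record instead of read off the run's window — its census
`not_smallnessFor_of_half_le`: [III] (2.7)'s `SmallnessFor γ …` is false at `γ ≥ 1∕2`, e.g. on K0a's witness `θ₀ˡⁱᵛᵉ`, `γ = 1∕2`) and, in its SPLIT with this seat, handed over the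
`θ₀ˡⁱᵛᵉ` term-pinned row.  Typing it exposed a second numeral of the witness: BOTH discharge forms need the LEVEL inputs `2 ≤ N₀` and `N₀ ≤ τ9.Nmem` (print: `h = k − N`
p. 178, `k₀ = k − N₀` p. 181, `N₀` with `O(1)B₃B₅M⁵L₀^{−2(N₀−1)} ≤ ¼` p. 200), and K0a's tower numerics of record have `Nmem := 0` (`Record12Numerics` :135–138, «displayed
defaults `M := 1`, `Nsz := 0`, `Nmem := 0`»).  So AT `θ₀ˡⁱᵛᵉ = theta12LiveOfRecord F N ζ Rz Zt` (any residual objects) the discharge's hypotheses are CONTRADICTORY (§1,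
`not_levels189_theta12Live`) — the handed-over row would be vacuous and is NOT typed; on the witness line of record N12's (1.89) slot is carried RAW (module 3 §3, module 4
§4's left disjunct).  What IS typed (§2): the window-free leaf ∕ pointed row at a GENERIC live re-pin `Θ.liveRepin` — contentful for every `Θ` with `Θ.τ9.Nmem ≥ N₀ ≥ 2`.
WHAT THIS FILE PROVES (theorems only).
* §1 CENSUS (`rfl` ∕ `omega`): `towerNumericsOfRecord₁₂_Nmem` (`= 0`), `theta12LiveOfRecord_Nmem` (`θ₀ˡⁱᵛᵉ.τ9.Nmem = 0`), `not_levels189_of_Nmem_zero`,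
  `not_levels189_theta12Live` (`¬ (2 ≤ N₀ ∧ N₀ ≤ θ₀ˡⁱᵛᵉ.τ9.Nmem)` — the level inputs of `h189_pinD189T_of_h180(_of_flow)` cannot be met at the witness numerics of record).
* §2 `b15Leaf_WOfRecord₁₀_pinAllT_liveRepin_of_massLive_of_h180_of_flow` — THE [IV] LEAF AT THE LIVE RE-PIN's TERM-PINNED BUNDLE OF RECORD, run with `kSel P < K`, WINDOW-FREE:
  from `Provisos₁₀` at the re-pin, positive mass of the LIVE terms, Prop. 1, (1.80), the four ℍ-leaves, geometry, numerics, print's p. 200 conditions, levels and the DISPLAYED flow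
  inputs `hε0 ∕ hε1 ∕ hflow` (module 2 §3 ∘ n12-e `h189_pinD189T_of_h180_of_flow`) — NO (1.89) display, NO `hfib`, NO `hdeg`, NO window, NO `SmallnessFor`, NO β-box;
  `b15Leaf_res_W_pinW_liveRepin_pinAllT_of_massLive_of_h180_of_flow` (pointed-row form, feeds module 4 §3's `h12`).
* §3 ON THE WITNESS LINE (any residual objects `ζ, Rz, Zt`): `new189_pinAllT_one_zero_theta12Live` (the RAW (1.89) display carried there is contentful: its antecedent holds at
  `(1, 0)` on every run in `]0, ½]`), `nodesAtSomeRecord₁₂_of_pointed_theta12Live_pinW_of_leaf` (module 4 §3's socket at `θ₀ˡⁱᵛᵉ`: K0′ side = `Provisos₁₂` + `ZtUnity`, the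
  children's rows, `h12 : ∀ P, B15Leaf (W₀ P)` handed run by run; admissibility, signs, guard and N13's 𝐑-row are theorems).
DESIGN INPUT (located, for the K0a lineage's numerics-of-the-family successor and dag-lead's RECORD13 closability gate; count-neutral): a witness that is to serve N12's
printed (1.89) route needs tower numerics with `Nmem ≥ N₀ ≥ 2` and a window `γ` with `log γ⁻² ≥ 4p₀ + 2`; at `M = 1` print's second p. 200 condition is met only through the
closer's `δ`, `B₃`, `B₅`, `O(1)`.  One finite four-torus programme at fixed `ε`; nothing continuum ∕ ℝ⁴ ∕ OS ∕ mass gap ∕ Clay.  0 `sorry`, 0 `def`, standard axioms.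
Filed `--supports` K1′ (19903) `--as helper`.
Sources: [Balaban1989LargeFieldI] (0.2)–(0.6) pp.176–177, p.178, p.181, Prop. 1 p.194, (1.80) p.195, (1.88)–(1.89) p.198, pp.199–200; [Balaban1988Convergent] (2.1) p.254,
(2.7)–(2.8) pp.255–256, (2.18) p.257; [Balaban1989LargeFieldII] Thm 1 + (0.1) pp.355–356.
-/

noncomputable section

open MeasureTheory
open scoped Matrix.Norms.L2Operator

namespace Summit.QuantumFields.YangMills.BalabanUVNodes.N12AtRecord12TermPinnedFlow
open Literature.MathematicalPhysics.QuantumFieldTheory.Balaban1983to89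
open Literature.MathematicalPhysics.QuantumFieldTheory.Balaban1983to89.T4Continuum (T4Family)
open Literature.MathematicalPhysics.QuantumFieldTheory.Balaban1983to89.DagBinding (WorldP leavesP PrintedCarriersR PrintedCarriers15 B15Leaf B8LeafR B9LeafX B11Leaf Nodes)
open Literature.MathematicalPhysics.QuantumFieldTheory.Balaban1983to89.Node00
open B15Claim189Assembly (Setting189 new189 chiPP dom half)
open B15 (Prop1Printed Ineq180)
open B15.PrelimIntegrations (Ineq191 Ineq195)
open B15Chi124DetSets (E124)
open B15DeterminingSets (MSField)
open B14DomainGeom (Pt)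
open B8Eq17ClassAkV1 (plaqsOf)
open GaugeGroup (dist1)
open GaugeField (plaqHol)
open B15Claim189PrintedConditions (omegaOfChain h189_pinD189T_of_h180_of_flow)
open B16RLeafRecord12AtLive (kappa_nonneg_theta12OfRecord E0_nonneg_theta12OfRecord B0_nonneg_theta12OfRecord)
open Summit.QuantumFields.YangMills.BalabanUVNodes.N12AtRecord12LiveSelector (b15Leaf_WOfRecord₁₀_pinAllχ₀_liveRepin_of_massLive)
open Summit.QuantumFields.YangMills.BalabanUVNodes.N12AtRecord12TermPinned (new189_pinAllT_one_zero₁₂ nodesAtSomeRecord₁₂_of_pointed_liveRepin_pinW_of_leaf)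

variable {N : ℕ} [NeZero N] {F : T4Family}

/-! ## §1 Census: the (1.89) discharge's level inputs cannot be met at the witness numerics of record (`Nmem = 0`) -/

section Census

/-- K0a's tower numerics of record carry NO large-field memory: `Nmem = 0` («displayed defaults», `Record12Numerics`). [cite: Balaban1989LargeFieldI, p.177 (condition (ii)'s `N`) (bookkeeping census)] -/
theorem towerNumericsOfRecord₁₂_Nmem : towerNumericsOfRecord₁₂.Nmem = 0 := rfl

/-- With `Nmem = 0` the level inputs `2 ≤ N₀ ≤ Nmem` of the (1.89) discharge are contradictory. [cite: Balaban1989LargeFieldI, p.178, p.181, p.200 (bookkeeping census)] -/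
theorem not_levels189_of_Nmem_zero {τ : TowerNumerics} (hτ : τ.Nmem = 0) (N₀ : ℕ) : ¬ (2 ≤ N₀ ∧ N₀ ≤ τ.Nmem) := by
  rintro ⟨h2, hN⟩
  omega

variable (ζ : ZetaOfRecord F N numerics7OfRecord₁₂ 1) (Rz : (K : ℕ) → Sect2.Residual (F.P K) (MatA N)) (Zt : (K : ℕ) → TkResidualW F N (FluctV N) K)

/-- **`θ₀ˡⁱᵛᵉ.τ9.Nmem = 0`** for every choice of the residual objects (`rfl`). [cite: Balaban1989LargeFieldI, p.177 (bookkeeping census)] -/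
theorem theta12LiveOfRecord_Nmem : (theta12LiveOfRecord F N ζ Rz Zt).τ9.Nmem = 0 := rfl

/-- **★ CENSUS: AT `θ₀ˡⁱᵛᵉ` THE LEVEL INPUTS OF n12-e's `h189_pinD189T_of_h180` ∕ `…_of_flow` CANNOT BE MET** — `2 ≤ N₀ ∧ N₀ ≤ θ₀ˡⁱᵛᵉ.τ9.Nmem` is FALSE for every `N₀` (print
needs `N ≥ N₀ ≥ 2`: `h = k − N` p. 178, `k₀ = k − N₀` p. 181, p. 200).  Hence on K0a's witness line N12's (1.89) display is carried RAW, never discharged from (1.80) + the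
ℍ-leaves; a witness serving the printed route needs `Nmem ≥ 2`.  LOCATED, count-neutral; nothing about K0′'s statement. [cite: Balaban1989LargeFieldI, p.177, p.178, p.181, (1.89) p.198, p.200 (bookkeeping census)] -/
theorem not_levels189_theta12Live (N₀ : ℕ) : ¬ (2 ≤ N₀ ∧ N₀ ≤ (theta12LiveOfRecord F N ζ Rz Zt).τ9.Nmem) :=
  not_levels189_of_Nmem_zero (theta12LiveOfRecord_Nmem ζ Rz Zt) N₀

end Census

/-! ## §2 The [IV] leaf at the live re-pin's term-pinned bundle of record — WINDOW-FREE form (flow inputs displayed) -/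

section Leaf
variable (Θ : Stage12Params F N) (lam : ResidW F N) (σ : ∀ P : B12.RunParams, Sit189 F N P.K)
  (s : ∀ P : B12.RunParams, SeqOfRecord F Θ.ν Θ.τ9.M (gOfRecord₁₀ F N (Θ.liveRepin F N).toStage9Params P) P.K (lam.kSel P + 1)) (N₀ p₁ : ℕ)

/-- **★ THE [IV] LEAF AT `WOfRecord₁₀ θ₉ λᵀ P` (`θ₉` the live re-pin's Stage-9 tuple), run with `kSel P < K`, WINDOW-FREE** — module 2's
`b15Leaf_WOfRecord₁₀_pinAllχ₀_liveRepin_of_massLive` at `σᵀ` with the `h189` slot SUPPLIED by n12-e's `h189_pinD189T_of_h180_of_flow`.  DISPLAYED: `Provisos₁₀` at the re-pin,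
positive mass of the LIVE pre-𝐑 terms, Prop. 1 at `λ.LF P`, (1.80) (`h180`), the four ℍ-leaves, geometry (`hZk hgeom hbox`), residual numerics and signs, print's two p. 200 conditions,
levels `2 ≤ N₀ ≤ Θ.τ9.Nmem`, `N₀ ≤ kSel P + 1`, and the FLOW INPUTS at the thresholds of record `ε_i = epsOfRecord Θ.ν (g P) i`: `0 ≤ ε_i ≤ 1∕10` on `[kSel P + 1 − N, kSel P + 1]`,
(2.8) with `0 ≤ β₀ ≤ ½`.  Contentful for `Θ.τ9.Nmem ≥ 2` (NOT at K0a's `θ₀ˡⁱᵛᵉ`, §1). [cite: Balaban1989LargeFieldI, (0.2)–(0.6) p.176, p.176 ll.14–16, Prop. 1 (1.78) p.194, (1.80) p.195, (1.88)–(1.89) p.198, pp.199–200; Balaban1988Convergent, (2.1) p.254, (2.8) p.256] -/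
theorem b15Leaf_WOfRecord₁₀_pinAllT_liveRepin_of_massLive_of_h180_of_flow (hP : (Θ.liveRepin F N).toStage9Params.Provisos₁₀) {P : B12.RunParams}
    (hK : lam.kSel P < P.K)
    {D : Setting189 (F.P P.K) (SU N) (MSField (F.P P.K) (SU N) × ((j : ℕ) → VecField (F.P P.K) j (EuclideanSpace ℝ (Fin (N ^ 2 - 1))))) (Pt (F.P P.K).d)}
    (hD : D = ((lam.pinRPrime (Θ.liveRepin F N).toStage9Params).pinD189T (Θ.liveRepin F N).toStage9Params σ s N₀ p₁).D189 P)
    (hmassLive : ∀ a, LiveSeq F N Θ.ν Θ.τ9 P (gOfRecord₁₀ F N (Θ.liveRepin F N).toStage9Params P) (lam.kSel P + 1)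
        (slotsTOfRecord F N Θ.ν Θ.τ9 (EOfRecord₁₀ F N (Θ.liveRepin F N).toStage9Params) (wOfRecord₉ F N (Θ.liveRepin F N).toStage9Params)
          (Θ.liveRepin F N).ppSel P (gOfRecord₁₀ F N (Θ.liveRepin F N).toStage9Params P) (lam.kSel P + 1)) a →
      0 < ∫ V, rterm (repTOfRecord9 F N Θ.ν Θ.τ9 (EOfRecord₁₀ F N (Θ.liveRepin F N).toStage9Params) (wOfRecord₉ F N (Θ.liveRepin F N).toStage9Params)
        (Θ.liveRepin F N).ppSel P (gOfRecord₁₀ F N (Θ.liveRepin F N).toStage9Params P) (lam.kSel P)) a V ∂(fieldMeasure (F.P P.K) (lam.kSel P + 1) (SU N)))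
    (hP1 : Prop1Printed (lam.LF P))
    -- levels, residual numerics, print's two conditions (p. 200)
    (hN2 : 2 ≤ N₀) (hNN : N₀ ≤ Θ.τ9.Nmem) (hNk : N₀ ≤ lam.kSel P + 1)
    (hβ0 : 0 ≤ (σ P).β) (hβ : (σ P).β ≤ 1 / 4) (hL₀ : 2 ≤ (σ P).L₀) (hL₀L : (σ P).L₀ ^ 2 ≤ ((F.P P.K).L : ℝ))
    (hB : 0 ≤ (σ P).O1 * (σ P).B₃ * (σ P).B₅) (hδ : 0 ≤ (σ P).δ) (hdist : ∀ p, 0 ≤ (σ P).dist p)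
    (hN₀ : (2 + (121 / 120) ^ 2 * ((σ P).O1 * (σ P).B₃ * (σ P).B₅ * (Θ.τ9.M : ℝ) ^ 5)) * (((σ P).L₀ ^ 2) ^ (N₀ - 1))⁻¹ ≤ 1 / 4)
    (hMl : (121 / 120) ^ 2 * ((σ P).O1 * (σ P).B₃ * (σ P).B₅ * (Θ.τ9.M : ℝ) ^ 5) * Real.exp (-(4 * (σ P).δ * (Θ.τ9.M : ℝ))) ≤ 1 / 12)
    -- the flow inputs DISPLAYED at the thresholds of record
    (hε0 : ∀ i, lam.kSel P + 1 - Θ.τ9.Nmem ≤ i → i ≤ lam.kSel P + 1 →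
      0 ≤ epsOfRecord Θ.ν (gOfRecord₁₀ F N (Θ.liveRepin F N).toStage9Params P) i)
    (hε1 : ∀ i, lam.kSel P + 1 - Θ.τ9.Nmem ≤ i → i ≤ lam.kSel P + 1 →
      epsOfRecord Θ.ν (gOfRecord₁₀ F N (Θ.liveRepin F N).toStage9Params P) i ≤ 1 / 10)
    {β₀ : ℝ} (hβ₀0 : 0 ≤ β₀) (hβ₀ : β₀ ≤ 1 / 2)
    (hflow : ∀ j, lam.kSel P + 1 - Θ.τ9.Nmem ≤ j → j < lam.kSel P + 1 →
      epsOfRecord Θ.ν (gOfRecord₁₀ F N (Θ.liveRepin F N).toStage9Params P) (lam.kSel P + 1) ≤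
        (1 + β₀) * Real.sqrt ((lam.kSel P + 1 - j : ℕ) : ℝ) * epsOfRecord Θ.ν (gOfRecord₁₀ F N (Θ.liveRepin F N).toStage9Params P) j)
    -- located geometry
    (hZk : ∀ m, lam.kSel P + 1 - N₀ < m → m < lam.kSel P + 1 → (σ P).Zpp (lam.kSel P + 1) ∩ omegaOfChain (s P) m ⊆ omegaOfChain (s P) (m + 1))
    (hgeom : ∀ m, D.k₀ < m → m < D.k → ∀ p ∈ plaqsOf (D.Ω m \ D.Ω (m + 1)), 4 * ((m : ℝ) - D.k₀) * D.M ≤ D.dist p)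
    (hbox : ∀ p ∈ plaqsOf (half D), D.boxOf p ∈ D.halfcubes ∧ p ∈ D.plaqT (D.boxOf p))
    -- the four ℍ-leaves and (1.80)
    (L91h : ∀ U, new189 D U → ∀ p ∈ plaqsOf (half D),
      Ineq191 (dist1 (plaqHol (D.Upp U) p)) (D.devV'' U p) D.α ((D.L ^ D.h)⁻¹) (D.ε D.h) (E124 D.ε D.L D.η D.k D.h))
    (L95 : ∀ U, new189 D U → ∀ p ∈ plaqsOf (half D),
      Ineq195 (D.devV'' U p) (dist1 (plaqHol (D.Uhalf U (D.boxOf p)) p)) D.α ((D.L ^ D.h)⁻¹) (D.ε D.h) (E124 D.ε D.L D.η D.k D.h))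
    (L91 : ∀ U, new189 D U → ∀ j, D.h ≤ j → j ≤ D.k → ∀ p ∈ plaqsOf (dom D j),
      Ineq191 (dist1 (plaqHol (D.Upp U) p)) (D.dev97 U p) D.α ((D.L ^ j)⁻¹) (D.ε j) (E124 D.ε D.L D.η D.k j))
    (L97 : ∀ U, new189 D U → ∀ j, D.h ≤ j → j ≤ D.k → ∀ p ∈ plaqsOf (dom D j),
      Ineq191 (D.dev97 U p) (D.dev0 U p) D.α ((D.L ^ j)⁻¹) (D.ε j) (E124 D.ε D.L D.η D.k j))
    (h180 : ∀ U, new189 D U → ∀ i, D.h ≤ i → i ≤ D.k → ∀ q ∈ plaqsOf (dom D i),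
      Ineq180 (D.dev0 U q) (D.ε D.k) D.η D.B₃ D.B₅ D.M D.δ (D.dist q) D.O1) :
    B15Leaf (WOfRecord₁₀ F N (Θ.liveRepin F N).toStage9Params
      ((lam.pinRPrime (Θ.liveRepin F N).toStage9Params).pinD189T (Θ.liveRepin F N).toStage9Params σ s N₀ p₁) P) := by
  subst hD
  exact b15Leaf_WOfRecord₁₀_pinAllχ₀_liveRepin_of_massLive Θ lam (fun P => ((σ P).pinTerm (s P)).pinNumerics Θ.τ9 N₀) p₁ hP hK hmassLive hP1
    (fun U hU i hi hik q hq => h180 U hU i hi hik q hq)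
    (h189_pinD189T_of_h180_of_flow (lam := lam.pinRPrime (Θ.liveRepin F N).toStage9Params) (σT := σ) (sT := s) (N₀ := N₀) (p₁ := p₁) P hN2 hNN hNk
      hβ0 hβ hL₀ hL₀L hB hδ hdist hN₀ hMl hε0 hε1 hβ₀0 hβ₀ hflow hZk hgeom hbox L91h L95 L91 L97 h180)

/-- **N12's POINTED ROW at `pinW (WOfRecord₁₂ θ₉′ λᵀ)`, run with `kSel P < K`, WINDOW-FREE** (the previous theorem read as `B15Leaf ((θ₉′.pinW W₀).res.W P)`; hand it as `h12 P` to
module 4 §3's `nodes₁₂_pointed_liveRepin_pinW_of_leaf`). [cite: Balaban1989LargeFieldI, (0.2)–(0.6) p.176, Prop. 1 (1.78) p.194, (1.80) p.195, (1.89) p.198; Balaban1989LargeFieldII, Thm 1 p.355 (bookkeeping)] -/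
theorem b15Leaf_res_W_pinW_liveRepin_pinAllT_of_massLive_of_h180_of_flow (hP : (Θ.liveRepin F N).toStage9Params.Provisos₁₀) {P : B12.RunParams}
    (hK : lam.kSel P < P.K)
    {D : Setting189 (F.P P.K) (SU N) (MSField (F.P P.K) (SU N) × ((j : ℕ) → VecField (F.P P.K) j (EuclideanSpace ℝ (Fin (N ^ 2 - 1))))) (Pt (F.P P.K).d)}
    (hD : D = ((lam.pinRPrime (Θ.liveRepin F N).toStage9Params).pinD189T (Θ.liveRepin F N).toStage9Params σ s N₀ p₁).D189 P)
    (hmassLive : ∀ a, LiveSeq F N Θ.ν Θ.τ9 P (gOfRecord₁₀ F N (Θ.liveRepin F N).toStage9Params P) (lam.kSel P + 1)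
        (slotsTOfRecord F N Θ.ν Θ.τ9 (EOfRecord₁₀ F N (Θ.liveRepin F N).toStage9Params) (wOfRecord₉ F N (Θ.liveRepin F N).toStage9Params)
          (Θ.liveRepin F N).ppSel P (gOfRecord₁₀ F N (Θ.liveRepin F N).toStage9Params P) (lam.kSel P + 1)) a →
      0 < ∫ V, rterm (repTOfRecord9 F N Θ.ν Θ.τ9 (EOfRecord₁₀ F N (Θ.liveRepin F N).toStage9Params) (wOfRecord₉ F N (Θ.liveRepin F N).toStage9Params)
        (Θ.liveRepin F N).ppSel P (gOfRecord₁₀ F N (Θ.liveRepin F N).toStage9Params P) (lam.kSel P)) a V ∂(fieldMeasure (F.P P.K) (lam.kSel P + 1) (SU N)))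
    (hP1 : Prop1Printed (lam.LF P))
    (hN2 : 2 ≤ N₀) (hNN : N₀ ≤ Θ.τ9.Nmem) (hNk : N₀ ≤ lam.kSel P + 1)
    (hβ0 : 0 ≤ (σ P).β) (hβ : (σ P).β ≤ 1 / 4) (hL₀ : 2 ≤ (σ P).L₀) (hL₀L : (σ P).L₀ ^ 2 ≤ ((F.P P.K).L : ℝ))
    (hB : 0 ≤ (σ P).O1 * (σ P).B₃ * (σ P).B₅) (hδ : 0 ≤ (σ P).δ) (hdist : ∀ p, 0 ≤ (σ P).dist p)
    (hN₀ : (2 + (121 / 120) ^ 2 * ((σ P).O1 * (σ P).B₃ * (σ P).B₅ * (Θ.τ9.M : ℝ) ^ 5)) * (((σ P).L₀ ^ 2) ^ (N₀ - 1))⁻¹ ≤ 1 / 4)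
    (hMl : (121 / 120) ^ 2 * ((σ P).O1 * (σ P).B₃ * (σ P).B₅ * (Θ.τ9.M : ℝ) ^ 5) * Real.exp (-(4 * (σ P).δ * (Θ.τ9.M : ℝ))) ≤ 1 / 12)
    (hε0 : ∀ i, lam.kSel P + 1 - Θ.τ9.Nmem ≤ i → i ≤ lam.kSel P + 1 →
      0 ≤ epsOfRecord Θ.ν (gOfRecord₁₀ F N (Θ.liveRepin F N).toStage9Params P) i)
    (hε1 : ∀ i, lam.kSel P + 1 - Θ.τ9.Nmem ≤ i → i ≤ lam.kSel P + 1 →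
      epsOfRecord Θ.ν (gOfRecord₁₀ F N (Θ.liveRepin F N).toStage9Params P) i ≤ 1 / 10)
    {β₀ : ℝ} (hβ₀0 : 0 ≤ β₀) (hβ₀ : β₀ ≤ 1 / 2)
    (hflow : ∀ j, lam.kSel P + 1 - Θ.τ9.Nmem ≤ j → j < lam.kSel P + 1 →
      epsOfRecord Θ.ν (gOfRecord₁₀ F N (Θ.liveRepin F N).toStage9Params P) (lam.kSel P + 1) ≤
        (1 + β₀) * Real.sqrt ((lam.kSel P + 1 - j : ℕ) : ℝ) * epsOfRecord Θ.ν (gOfRecord₁₀ F N (Θ.liveRepin F N).toStage9Params P) j)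
    (hZk : ∀ m, lam.kSel P + 1 - N₀ < m → m < lam.kSel P + 1 → (σ P).Zpp (lam.kSel P + 1) ∩ omegaOfChain (s P) m ⊆ omegaOfChain (s P) (m + 1))
    (hgeom : ∀ m, D.k₀ < m → m < D.k → ∀ p ∈ plaqsOf (D.Ω m \ D.Ω (m + 1)), 4 * ((m : ℝ) - D.k₀) * D.M ≤ D.dist p)
    (hbox : ∀ p ∈ plaqsOf (half D), D.boxOf p ∈ D.halfcubes ∧ p ∈ D.plaqT (D.boxOf p))
    (L91h : ∀ U, new189 D U → ∀ p ∈ plaqsOf (half D),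
      Ineq191 (dist1 (plaqHol (D.Upp U) p)) (D.devV'' U p) D.α ((D.L ^ D.h)⁻¹) (D.ε D.h) (E124 D.ε D.L D.η D.k D.h))
    (L95 : ∀ U, new189 D U → ∀ p ∈ plaqsOf (half D),
      Ineq195 (D.devV'' U p) (dist1 (plaqHol (D.Uhalf U (D.boxOf p)) p)) D.α ((D.L ^ D.h)⁻¹) (D.ε D.h) (E124 D.ε D.L D.η D.k D.h))
    (L91 : ∀ U, new189 D U → ∀ j, D.h ≤ j → j ≤ D.k → ∀ p ∈ plaqsOf (dom D j),
      Ineq191 (dist1 (plaqHol (D.Upp U) p)) (D.dev97 U p) D.α ((D.L ^ j)⁻¹) (D.ε j) (E124 D.ε D.L D.η D.k j))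
    (L97 : ∀ U, new189 D U → ∀ j, D.h ≤ j → j ≤ D.k → ∀ p ∈ plaqsOf (dom D j),
      Ineq191 (D.dev97 U p) (D.dev0 U p) D.α ((D.L ^ j)⁻¹) (D.ε j) (E124 D.ε D.L D.η D.k j))
    (h180 : ∀ U, new189 D U → ∀ i, D.h ≤ i → i ≤ D.k → ∀ q ∈ plaqsOf (dom D i),
      Ineq180 (D.dev0 U q) (D.ε D.k) D.η D.B₃ D.B₅ D.M D.δ (D.dist q) D.O1) :
    B15Leaf (((Θ.liveRepin F N).pinW F N (WOfRecord₁₂ F N (Θ.liveRepin F N)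
      ((lam.pinRPrime (Θ.liveRepin F N).toStage9Params).pinD189T (Θ.liveRepin F N).toStage9Params σ s N₀ p₁))).res.W P) :=
  b15Leaf_WOfRecord₁₀_pinAllT_liveRepin_of_massLive_of_h180_of_flow Θ lam σ s N₀ p₁ hP hK hD hmassLive hP1 hN2 hNN hNk hβ0 hβ hL₀ hL₀L hB hδ hdist hN₀ hMl
    hε0 hε1 hβ₀0 hβ₀ hflow hZk hgeom hbox L91h L95 L91 L97 h180

end Leaf

/-! ## §3 On K0a's witness line: non-vacuity of the displays at `λᵀ`, and module 4 §3's socket (`h12` handed run by run) with every K0′-side input but the provisos a theorem -/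

section Theta
variable (ζ : ZetaOfRecord F N numerics7OfRecord₁₂ 1) (Rz : (K : ℕ) → Sect2.Residual (F.P K) (MatA N)) (Zt : (K : ℕ) → TkResidualW F N (FluctV N) K)
  (lam : ResidW F N) (σ : ∀ P : B12.RunParams, Sit189 F N P.K)
  (s : ∀ P : B12.RunParams, SeqOfRecord F numerics7OfRecord₁₂ 1 (gOfRecord₁₀ F N (theta12LiveOfRecord F N ζ Rz Zt).toStage9Params P) P.K (lam.kSel P + 1))
  (N₀ p₁ : ℕ)

/-- **AT `θ₀ˡⁱᵛᵉ` THE (1.80) ∕ (1.89) ANTECEDENT AT `λᵀ` HOLDS AT `(1, 0)` ON EVERY RUN IN THE WINDOW `]0, ½]` UP TO `n ≥ kSel P + 1`** (module 4's `new189_pinAllT_one_zero₁₂` at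
`θ := theta12OfRecord …`, admissibility K0a's): the RAW (1.89) display carried on the witness line (§1) is contentful there. [cite: Balaban1989LargeFieldI, (1.82) p.196, (1.89) p.198; Balaban1988Convergent, (2.4) p.255, (2.12) p.256 (bookkeeping census)] -/
theorem new189_pinAllT_one_zero_theta12Live (P : B12.RunParams) {n : ℕ}
    (hI : Step.InInterval (1 / 2) n (gOfRecord₁₀ F N (theta12LiveOfRecord F N ζ Rz Zt).toStage9Params P)) (hkn : lam.kSel P + 1 ≤ n) :
    new189 (((lam.pinRPrime (theta12LiveOfRecord F N ζ Rz Zt).toStage9Params).pinD189T (theta12LiveOfRecord F N ζ Rz Zt).toStage9Params σ s N₀ p₁).D189 P)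
      ((1 : MSField (F.P P.K) (SU N)), fun _ _ => (0 : EuclideanSpace ℝ (Fin (N ^ 2 - 1)))) :=
  new189_pinAllT_one_zero₁₂ (theta12OfRecord F N ζ Rz Zt) lam σ s N₀ p₁ (admissible_theta12OfRecord F N ζ Rz Zt) P hI hkn

variable (W₀ : B12.RunParams → PrintedCarriers15)

/-- **★ THE `stub_nodes12` BODY AT `θ₀ˡⁱᵛᵉ` W-PINNED AT ANY `W₀`, N12's ROW HANDED RUN BY RUN — K0′ SIDE = `Provisos₁₂` + `ZtUnity`** (module 4 §3's
`nodesAtSomeRecord₁₂_of_pointed_liveRepin_pinW_of_leaf` at `Θ := theta12OfRecord F N ζ Rz Zt`: admissibility and the signs `κ = E₀ = B₀ = 1` are K0a ∕ n11-e theorems; the guard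
conjunct and N13's 𝐑-row are discharged inside).  For ANY residual objects `(ζ, Rz, Zt)` — the K1′ witness-to-be as much as K0′'s inhabitant.  Rows N05–N10 at `θ₀`'s residual
carriers, N11's (S1ᵀ), the Cor.-3 leaves; `h12 : ∀ P, B15Leaf (W₀ P)` (from §2 ∕ module 4 §2 ∕ n12-e's `…TermPin` §1 at `W₀ := WOfRecord₁₂ θ₀ˡⁱᵛᵉ λᵀ`, the (1.89) slot RAW on
this line by §1).  COMPOSITE; NOT a discharge; count-neutral. [cite: Balaban1989LargeFieldII, Thm 1 p.355 + p.391; Balaban1988Convergent, p.244, Thm 2 p.263, (3.16)–(3.22) pp.268–269, (3.24) p.270; Balaban1989LargeFieldI, (0.3)–(0.4) p.176 (bookkeeping: the stub's body on the witness line)] -/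
theorem nodesAtSomeRecord₁₂_of_pointed_theta12Live_pinW_of_leaf (hP : (theta12LiveOfRecord F N ζ Rz Zt).Provisos₁₂ F N)
    (hzt : (theta12LiveOfRecord F N ζ Rz Zt).ZtUnity F N)
    (w : WorldP) (hC : w.C = (datumOfRecord₁₂ F N (theta12LiveOfRecord F N ζ Rz Zt) hP).C) (hγ : 0 < w.γ ∧ w.γ ≤ 1 / 2) (hL : w.L = 3)
    (hup : ∀ P, w.up P = upOfRecord₅C F N (((theta12LiveOfRecord F N ζ Rz Zt).pinW F N W₀).toStage5₁₂ F N) P)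
    (h05 : ∀ P : B12.RunParams,
      B8LeafR ((theta12OfRecord F N ζ Rz Zt).res.X P).d8 ((theta12OfRecord F N ζ Rz Zt).res.X P).L8 ((theta12OfRecord F N ζ Rz Zt).res.X P).C₂
        ((theta12OfRecord F N ζ Rz Zt).res.X P).B₁' ((theta12OfRecord F N ζ Rz Zt).res.X P).B₀' ((theta12OfRecord F N ζ Rz Zt).res.X P).B₁
        ((theta12OfRecord F N ζ Rz Zt).res.X P).B₂ ((theta12OfRecord F N ζ Rz Zt).res.X P).c₁ ((theta12OfRecord F N ζ Rz Zt).res.X P).inp8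
        ((theta12OfRecord F N ζ Rz Zt).res.X P).B₀β ((theta12OfRecord F N ζ Rz Zt).res.X P).loc8 ((theta12OfRecord F N ζ Rz Zt).res.X P).fam8R
        ((theta12OfRecord F N ζ Rz Zt).res.X P).lan8 ((theta12OfRecord F N ζ Rz Zt).res.X P).cub8 ((theta12OfRecord F N ζ Rz Zt).res.X P).toAxial8)
    (h06 : ∀ P : B12.RunParams, B9LeafX ((theta12OfRecord F N ζ Rz Zt).res.Y P))
    (h07 : ∀ P : B12.RunParams, B11Leaf ((theta12OfRecord F N ζ Rz Zt).res.Z P))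
    (h08 : ∀ P : B12.RunParams, ∃ (Xc : PrintedCarriersR) (I : Type) (C : B10Assembly.Consts) (T : I → B10.TowerRun),
      Nonempty (∀ i, B10Assembly.LeafSystem C (T i)) ∧ (theta12OfRecord F N ζ Rz Zt).res.X P = Xc.withTowerRuns10 T)
    (h09 : ∀ P : B12.RunParams, B12Sec2to5.Lemma4Printed ((theta12OfRecord F N ζ Rz Zt).res.X P).F12 ((theta12OfRecord F N ζ Rz Zt).res.X P).c12)
    (h09T : ∀ P : B12.RunParams, (leavesP w P).smallCouplings → (leavesP w P).smallFieldInductive)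
    (h10 : ∀ P : B12.RunParams, B9LeafX ((theta12OfRecord F N ζ Rz Zt).res.Y P) →
      (B10.Thm1PrintedCompact ((theta12OfRecord F N ζ Rz Zt).res.X P).runs10 ∧ B10.Thm2Printed ((theta12OfRecord F N ζ Rz Zt).res.X P).runs10) →
        B11Leaf ((theta12OfRecord F N ζ Rz Zt).res.Z P) →
          B12Sec2to5.Lemma4Printed ((theta12OfRecord F N ζ Rz Zt).res.X P).F12 ((theta12OfRecord F N ζ Rz Zt).res.X P).c12 →
            B13.Lemma1Printed ((theta12OfRecord F N ζ Rz Zt).res.X P).S13 ((theta12OfRecord F N ζ Rz Zt).res.X P).c13 ∧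
              B13.Lemma2Printed ((theta12OfRecord F N ζ Rz Zt).res.X P).S13 ((theta12OfRecord F N ζ Rz Zt).res.X P).c13 ∧
                B13.Lemma3Printed ((theta12OfRecord F N ζ Rz Zt).res.X P).S13 ((theta12OfRecord F N ζ Rz Zt).res.X P).c13)
    (h11 : ∀ P : B12.RunParams, (leavesP w P).b7 → (leavesP w P).b8 → (leavesP w P).b9 → (leavesP w P).b10 → (leavesP w P).b11 →
      (leavesP w P).smallCouplings → (leavesP w P).smallFieldInductive → (leavesP w P).flowControl →
        ∀ k, k < P.K → SLaw₁₂ F N (theta12LiveOfRecord F N ζ Rz Zt) P k → TLaw₁₂ F N (theta12LiveOfRecord F N ζ Rz Zt) P k)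
    (h12 : ∀ P : B12.RunParams, B15Leaf (W₀ P))
    (hcor3 : ∃ R : B14Cor3.ReprFamily (datumOfRecord₁₂ F N (theta12LiveOfRecord F N ζ Rz Zt) hP).C,
      B14Cor3.LeafH (datumOfRecord₁₂ F N (theta12LiveOfRecord F N ζ Rz Zt) hP).C R w.γ ∧
        B14Cor3.LeafU1 (datumOfRecord₁₂ F N (theta12LiveOfRecord F N ζ Rz Zt) hP).C R w.γ ∧
          B14Cor3.LeafU2 (datumOfRecord₁₂ F N (theta12LiveOfRecord F N ζ Rz Zt) hP).C R w.γ w.ep ∧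
            B14Cor3.LeafL1 (datumOfRecord₁₂ F N (theta12LiveOfRecord F N ζ Rz Zt) hP).C R w.γ ∧
              B14Cor3.LeafL2 (datumOfRecord₁₂ F N (theta12LiveOfRecord F N ζ Rz Zt) hP).C R w.γ w.em) :
    ∃ (θ' : Stage12Params F N) (h' : θ'.Provisos₁₂ F N) (w' : WorldP), (θ'.ZtUnity F N ∧ θ'.SlotsNondegenerate) ∧ θ'.Admissible F N ∧
      IsRecordOfRecord₁₂C F N (datumOfRecord₁₂ F N θ' h') w' ∧ ∀ P : B12.RunParams, Nodes (leavesP w' P) :=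
  nodesAtSomeRecord₁₂_of_pointed_liveRepin_pinW_of_leaf (theta12OfRecord F N ζ Rz Zt) hP W₀ (admissible_theta12OfRecord F N ζ Rz Zt) hzt
    (kappa_nonneg_theta12OfRecord F N ζ Rz Zt) (E0_nonneg_theta12OfRecord F N ζ Rz Zt) (B0_nonneg_theta12OfRecord F N ζ Rz Zt)
    w hC hγ hL hup h05 h06 h07 h08 h09 h09T h10 h11 h12 hcor3

end Theta

end Summit.QuantumFields.YangMills.BalabanUVNodes.N12AtRecord12TermPinnedFlow

end
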